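/-
Copyright (c) 2026. All rights reserved.
Released under Apache 2.0 license as described in the file LICENSE.
Authors: abc-iut cell — seat abc-iut-w4-d104 (gen 4): row «COR29-L-A-ENGAGE», part (L) — [AbsTopIII]
Cor 2.9 for the genuine datum with `L` the GERM structure of Prop 2.6 / Cor 2.7 (e) read in the charts
(successor of p436603 / p438727, which used the constant pull-back `planeStructure.comap (fun _ ↦ 0)`).
-/
import Literature.AnabelianGeometry.AbsoluteAnabelian.ArchimedeanReconstructionCor29PrimeGenuine
import HarnessLib

/-!
# [AbsTopIII] Cor 2.9 with `L` ENGAGED: any local linear holomorphic structure acting through its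
# multipliers, and the germ structure `𝒜_x = germAut (e_x x)` read in the Cor 2.8 (b) charts

S. Mochizuki, *Topics in absolute anabelian geometry III* (bib key `MochizukiAbsTopIII2015`), Cor 2.9
pp.64–65 with Prop 2.6 (a)(b) pp.57–58 and Cor 2.7 (e) p.60.  PROOF-ONLY file (no definitions), sequel of
p436603 / p438727 (abc-iut-w4-d104) and of abc-iut-L4-t4's successor statement `GlobalArchimedeanCompatibility'`
(p439757/p439772/p440549).  Those instances used `L := planeStructure.comap (fun _ ↦ 0)` — the CONSTANT
pull-back of the plane's germ group at `0`, with identity transitions, so that row b.r4 (compatibility with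
the `𝒜_{x₁} ⥲ 𝒜_{x₂}` of Cor 2.7 (e)) was trivial (abc-iut-f-075 reading R2 (i); L4-lead RULING #8d caveat (L)).
Here `L` is ENGAGED (row «COR29-L-A-ENGAGE», part (L); part (A) is the sibling `…Cor29AdditiveInput.lean`):

1. **Any `L`.**  For an ARBITRARY `L : LocalLinearHolStructure X` let `u ∈ 𝒜_x` act near `x` through its
   MULTIPLIER `c_u := (isoUnits x)⁻¹ u` in the chart `e_x`: `u · v := e_x⁻¹(e_x x + c_u (e_x v − e_x x))`.  Rows
   b.r1/b.r2 hold with the scalar isomorphism `(isoUnits x)⁻¹ ≫ κ^×` = t4's `fieldIsoScalar L x κ`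
   (`actionScalar_pkg_of`, `scalarFieldIso_pkg_of`), row b.r4 by the interface axiom `trans_isoUnits`
   (`scalarCompatibleWithTrans_of`, abc-iut-f-075's `isoUnits_symm_trans_compatible`):
   `NFCurveData.cor29Refined_of_chartPackage_of`, `NFCurveData.globalArchimedeanCompatibility'_of_chartPackage_of`.
2. **The germ structure.**  `L := planeStructure.comap (fun x ↦ e_x x)`: `𝒜_x := germAut (e_x x)` — the
   Prop 2.6 (a) group of germs at the chart image point, `= {z ↦ e_x x + c (z − e_x x)}` by the rigidity
   theorem `mem_germAut_iff` — with `trans` the translation conjugations `germAutTrans` of Prop 2.6 (b) (NOT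
   identities: `NFCurveData.germs_trans_eq`).  For this `L` the multiplier action IS the germ acting through
   the chart, `u · v = e_x⁻¹(act_{e_x x} u (e_x v))` (`Cor29Model.act`, whose germ is `u`: `Cor29Model.act_germ`;
   definitionally, `Cor29Model.act_apply`): `NFCurveData.cor29Refined_of_chartPackage_germs`, and GENUINE
   throughout (p438727's NF-point predicate and extended evaluation): `NFCurveData.cor29Refined_genuine_germs`,
   `NFCurveData.globalArchimedeanCompatibility'_genuine_germs` (the record p408225 follows by w5-d225's junction).

WHY THIS IS Cor 2.7 (e)'s STRUCTURE OF `𝕏_v` read in charts: print takes "the Aut-holomorphic space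
determined by `(X^top, 𝒜_X)` constructed in Corollary 2.8" (p.64 l.39–41), `𝒜_X(U_X) := f_U⁻¹ ∘ Aut^hol(U_v) ∘
f_U` (Cor 2.8 (b)); on a chart disc this IS, through `e_x = κ⁻¹ ∘ f_U`, a planar Aut-holomorphic disc `V ∋ e_x x`,
and Cor 2.7 (e)'s group there is abc-iut-w6-d024's `germAutFromAutHol V (e_x x)` `= germAut (e_x x)`
(`Cor27eGermAutFromAutHol`, PROVED: `cor27eGermAutFromAutHol_holds`; one-line junction filed separately once
that module builds; chart-independence of multipliers: w6-d024's `Cor27f.mem_germAutFromAutHol_iff`).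
HONEST SCOPE: the chart package (charts of `X^top` at the NF-points into `ℂ ≅ k_v`, chart expressions of the
NF-rational functions, a uniformiser) stays a NAMED hypothesis — the analytic structure of `X_v(k_v)` owed by
Thm 1.9 / Cor 2.8 outputs; local additive structures still chart-transported here; functoriality record-only.
Refereed pre-IUT material; nothing here bears on the disputed [IUTchIII] Cor. 3.12; typed ≠ endorsed.
-/

noncomputable section

namespace Literature.AnabelianGeometry.AbsoluteAnabelian

open _root_.Set _root_.Topology _root_.Filter _root_.Metric _root_.Function
open ArchimedeanReconstruction ArchimedeanReconstruction.Cor29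

/-! ## Step 1: rows (b) along a chart package for ANY local linear holomorphic structure -/

namespace ArchimedeanReconstruction.Cor29ChartPackage

variable {X : Type} [TopologicalSpace X]
variable {W : Set X} {e : X → ℂ} {e' : ℂ → X} {x : X} {r : ℝ}

section Values

variable {𝕜 : Type*} [NontriviallyNormedField 𝕜]

/-- **Row b.r1 for a chart package and ANY `L`** (`ActionScalar`): with `u ∈ 𝒜_x = L.A x` acting near `x`
through its multiplier `c_u := (L.isoUnits x)⁻¹ u` in the chart, `u · v := e⁻¹(e x + c_u (e v − e x))`, every
`u` has a UNIQUE scalar `a ∈ k_v^×` with `ι(u · v) = a • ι(v)` near `x`, namely `κ(c_u)`.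
[cite: MochizukiAbsTopIII2015, Corollary 2.9 (b) p.65] -/
theorem actionScalar_pkg_of (L : LocalLinearHolStructure X) (κ : ℂ ≃+* 𝕜) (κu : ℂˣ ≃ₜ* 𝕜ˣ)
    (hκu : ∀ c : ℂˣ, ((κu c : 𝕜ˣ) : 𝕜) = κ c)
    (hr : 0 < r) (hWo : IsOpen W) (hxW : x ∈ W) (he : ContinuousOn e W)
    (hem : MapsTo e W (ball (e x) r)) (he' : ContinuousOn e' (ball (e x) r))
    (he'm : MapsTo e' (ball (e x) r) W) (hl : ∀ v ∈ W, e' (e v) = v)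
    (hrt : ∀ w ∈ ball (e x) r, e (e' w) = w) :
    ActionScalar (𝕜 := 𝕜) (A := L.A x)
      (fun u v => e' (e x + ((((L.isoUnits x).symm u : ℂˣ) : ℂ) * (e v - e x)))) x
      (fun v => (κ (e v - e x)) • (LinearMap.id : 𝕜 →ₗ[𝕜] 𝕜)) := by
  intro u
  beta_reduce
  set c : ℂˣ := (L.isoUnits x).symm u with hc
  refine ⟨κu c, ?_, fun a ha => ?_⟩
  · have h := iota_pkgAct_eventually κ hWo hxW he hem hrt (c : ℂ)
    refine h.mono fun v hv => ?_
    rw [hv, hκu]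
  · obtain ⟨v, -, hne, hv⟩ := exists_ne_of_eventually_pkg hr hxW he' he'm hl hrt
      (ha.and (eventually_pkg_act hWo hxW he hem hrt (c : ℂ)))
    obtain ⟨hva, -, hv2⟩ := hv
    have h1 := LinearMap.congr_fun hva 1
    simp only [LinearMap.smul_apply, LinearMap.id_apply, smul_eq_mul, mul_one] at h1
    rw [hv2, add_sub_cancel_left, map_mul] at h1
    have hvx : κ (e v - e x) ≠ 0 := by
      rw [map_ne_zero_iff κ κ.injective]; exact sub_ne_zero.2 hne
    have h2 : κ (c : ℂ) = (a : 𝕜) := mul_right_cancel₀ hvx h1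
    exact Units.ext (by rw [hκu]; exact h2.symm)

/-- **Row b.r2 for a chart package and ANY `L`** (`ScalarFieldIso`): with the multiplier action of
`𝒜_x = L.A x` in the chart and the scalar isomorphism `E := (L.isoUnits x)⁻¹ ≫ κ^× : 𝒜_x ⥲ k_v^×`, `E` is the
scalar of the action and is additive for the action-defined sum w.r.t. the transported `+ₓ`.
[cite: MochizukiAbsTopIII2015, Corollary 2.9 (b) p.65] -/
theorem scalarFieldIso_pkg_of (L : LocalLinearHolStructure X) (κ : ℂ ≃+* 𝕜) (κu : ℂˣ ≃ₜ* 𝕜ˣ)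
    (hκu : ∀ c : ℂˣ, ((κu c : 𝕜ˣ) : 𝕜) = κ c)
    (hr : 0 < r) (hWo : IsOpen W) (hxW : x ∈ W) (he : ContinuousOn e W)
    (hem : MapsTo e W (ball (e x) r)) (he' : ContinuousOn e' (ball (e x) r))
    (he'm : MapsTo e' (ball (e x) r) W) (hl : ∀ v ∈ W, e' (e v) = v)
    (hrt : ∀ w ∈ ball (e x) r, e (e' w) = w) :
    ScalarFieldIso (𝕜 := 𝕜) L x
      (fun u v => e' (e x + ((((L.isoUnits x).symm u : ℂˣ) : ℂ) * (e v - e x))))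
      (fun a b => e' (e a + e b - e x))
      (fun v => (κ (e v - e x)) • (LinearMap.id : 𝕜 →ₗ[𝕜] 𝕜))
      ((L.isoUnits x).symm.trans κu) := by
  refine ⟨fun u => ?_, fun φ ψ χ h => ?_⟩
  · beta_reduce
    have h := iota_pkgAct_eventually κ hWo hxW he hem hrt ((((L.isoUnits x).symm u : ℂˣ) : ℂ))
    refine h.mono fun v hv => ?_
    rw [hv]
    congr 1
    exact (hκu _).symm
  · beta_reduce at h
    set cφ : ℂ := ((((L.isoUnits x).symm φ : ℂˣ) : ℂ)) with hcφ
    set cψ : ℂ := ((((L.isoUnits x).symm ψ : ℂˣ) : ℂ)) with hcψ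
    set cχ : ℂ := ((((L.isoUnits x).symm χ : ℂˣ) : ℂ)) with hcχ
    obtain ⟨v, -, hne, hv⟩ := exists_ne_of_eventually_pkg hr hxW he' he'm hl hrt
      ((h.and (eventually_pkg_act hWo hxW he hem hrt cφ)).and
        ((eventually_pkg_act hWo hxW he hem hrt cψ).and
          ((eventually_pkg_act hWo hxW he hem hrt cχ).and (eventually_pkg_act hWo hxW he hem hrt (cφ + cψ)))))
    obtain ⟨⟨hvχ, -, hφ⟩, ⟨-, hψ⟩, ⟨hχm, -⟩, ⟨hsm, -⟩⟩ := hv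
    have hvχ' : e' (e x + cχ * (e v - e x)) = e' (e x + (cφ + cψ) * (e v - e x)) := by
      rw [hvχ, hφ, hψ]
      congr 1
      ring
    have hinj : e x + cχ * (e v - e x) = e x + (cφ + cψ) * (e v - e x) := by
      rw [← hrt _ hχm, ← hrt _ hsm, hvχ']
    have hvx : e v - e x ≠ 0 := sub_ne_zero.2 hne
    have h3 : cχ * (e v - e x) = (cφ + cψ) * (e v - e x) := by linear_combination hinj
    have h4 := mul_right_cancel₀ hvx h3
    have key : ((((L.isoUnits x).symm.trans κu) χ : 𝕜ˣ) : 𝕜) =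
        ((((L.isoUnits x).symm.trans κu) φ : 𝕜ˣ) : 𝕜) + ((((L.isoUnits x).symm.trans κu) ψ : 𝕜ˣ) : 𝕜) := by
      simp only [ContinuousMulEquiv.trans_apply, hκu]
      rw [← map_add]
      exact congrArg κ h4
    exact key

omit [TopologicalSpace X] in
/-- **Row b.r4 for ANY `L`** (`ScalarCompatibleWithTrans`): the scalar isomorphisms
`E_x := (L.isoUnits x)⁻¹ ≫ κ^×` at two points are compatible with the transition isomorphism
`𝒜_{x₁} ⥲ 𝒜_{x₂}` — by the interface axiom `trans_isoUnits` of Prop 2.6 (b) ("compatible isomorphisms";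
abc-iut-f-075 `isoUnits_symm_trans_compatible`).  For the germ structure these transitions are the
translation conjugations `germAutTrans`, not identities. [cite: MochizukiAbsTopIII2015, Corollary 2.9 (b) p.65] -/
theorem scalarCompatibleWithTrans_of (L : LocalLinearHolStructure X) (κu : ℂˣ ≃ₜ* 𝕜ˣ) (x₁ x₂ : X) :
    ScalarCompatibleWithTrans (𝕜 := 𝕜) L x₁ x₂ ((L.isoUnits x₁).symm.trans κu)
      ((L.isoUnits x₂).symm.trans κu) := by
  unfold ScalarCompatibleWithTrans
  exact L.isoUnits_symm_trans_compatible κu x₁ x₂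

end Values

end ArchimedeanReconstruction.Cor29ChartPackage

/-! ## Cor 2.9 for the genuine datum with `L` engaged -/

namespace ArchimedeanReconstruction

open Cor29 Cor29ChartPackage

open Classical in
/-- **[AbsTopIII] Cor 2.9 for the GENUINE datum, refined rows, for ANY local linear holomorphic structure
`L` on `X^top`** under the chart-package hypothesis (binders verbatim those of p436603): `u ∈ 𝒜_x` acts near
`x` through its multiplier `(L.isoUnits x)⁻¹ u` in the chart `e_x`, the scalar isomorphisms are
`E_x := (L.isoUnits x)⁻¹ ≫ κ^×`, and row b.r4 holds by `trans_isoUnits`.  All other data as in p436603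
(`ω_x := k_v`, `df|_x := κ((G x f)′(e_x x))`, transported `+ₓ`, `(1/n)·ₓ` with the junk convention, `ι_x`).
[cite: MochizukiAbsTopIII2015, Corollary 2.9 pp.64–65] -/
theorem NFCurveData.cor29Refined_of_chartPackage_of (D : NFCurveData) (L : LocalLinearHolStructure D.Xtop)
    (isNFPoint : D.Xtop → Prop)
    (W : D.Xtop → Set D.Xtop) (e : D.Xtop → D.Xtop → ℂ) (e' : D.Xtop → ℂ → D.Xtop) (r : D.Xtop → ℝ)
    (hr : ∀ x, isNFPoint x → 0 < r x) (hW : ∀ x, isNFPoint x → IsOpen (W x) ∧ x ∈ W x)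
    (he : ∀ x, isNFPoint x → ContinuousOn (e x) (W x) ∧ MapsTo (e x) (W x) (ball (e x x) (r x)))
    (he' : ∀ x, isNFPoint x →
      ContinuousOn (e' x) (ball (e x x) (r x)) ∧ MapsTo (e' x) (ball (e x x) (r x)) (W x))
    (hl : ∀ x, isNFPoint x → ∀ v ∈ W x, e' x (e x v) = v)
    (hrt : ∀ x, isNFPoint x → ∀ w ∈ ball (e x x) (r x), e x (e' x w) = w)
    (fval : D.Fn → D.Xtop → D.kv) (vanishesAt : D.Fn → D.Xtop → Prop) (G : D.Xtop → D.Fn → ℂ → ℂ)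
    (κ : ℂ ≃+* D.kv) (hκ : Continuous κ) (hκ' : Continuous κ.symm)
    (hG : ∀ x, isNFPoint x → ∀ f, vanishesAt f x → DifferentiableAt ℂ (G x f) (e x x) ∧
      (∀ᶠ u in 𝓝 x, κ.symm (fval f u) = G x f (e x u)) ∧ fval f x = 0)
    (hvan : ∀ f x, vanishesAt f x → fval f x = 0)
    (hspan : ∀ x, isNFPoint x → ∃ f, vanishesAt f x ∧ deriv (G x f) (e x x) ≠ 0) :
    D.Cor29Refined L isNFPoint (fun _ => D.kv) (fun x f => κ (deriv (G x f) (e x x))) vanishesAt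
      (fun x a b => e' x (e x a + e x b - e x x))
      (fun x n v => if v ∈ W x ∧ ‖e x v - e x x‖ < r x / 2 then e' x (e x x + (e x v - e x x) / (n : ℂ)) else x)
      fval
      (fun x u v => e' x (e x x + ((((L.isoUnits x).symm u : ℂˣ) : ℂ) * (e x v - e x x)))) := by
  refine ⟨fun x hx => ?_, hvan, ?_⟩
  · -- row 0.r5: the differentials span `ω_x = k_v`
    intro ω
    obtain ⟨f, hf, hd⟩ := hspan x hx
    refine ⟨f, ω / κ (deriv (G x f) (e x x)), hf, ?_⟩
    have hne : κ (deriv (G x f) (e x x)) ≠ 0 := by rwa [map_ne_zero_iff κ κ.injective]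
    simp only [smul_eq_mul, div_mul_cancel₀ _ hne]
  · -- the pinned scalar isomorphisms are abc-iut-L4-t4's `fieldIsoScalar L x κ` (units part of `κ` after
    -- the multiplier), written through `unitsOfFieldIso` so that the junction is definitional
    refine ⟨fun x => {v | v ∈ W x ∧ ‖e x v - e x x‖ < r x / 2},
      fun x v => (κ (e x v - e x x)) • (LinearMap.id : D.kv →ₗ[D.kv] D.kv),
      fun x => (L.isoUnits x).symm.trans (unitsOfFieldIso κ hκ hκ'),
      fun x hx => ?_, fun x₁ x₂ _ _ => scalarCompatibleWithTrans_of L (unitsOfFieldIso κ hκ hκ') x₁ x₂⟩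
    obtain ⟨hWo, hxW⟩ := hW x hx
    obtain ⟨hec, hem⟩ := he x hx
    obtain ⟨he'c, he'm⟩ := he' x hx
    refine ⟨isLocalAddDatumAt_pkg (hr x hx) hWo hxW hec he'c he'm (hl x hx) (hrt x hx),
      iotaComputesLimits_pkg κ hκ (hr x hx) hxW he'c (hl x hx) (hrt x hx) (hG x hx),
      iotaIsEmbedding_pkg κ hκ hκ' hec he'c hem (hl x hx) (fun v hv => hv.1),
      iotaAdditive_pkg κ (hr x hx) (hrt x hx), iota_self_pkg κ,
      scalarFieldIso_pkg_of L κ (unitsOfFieldIso κ hκ hκ') (fun c => rfl) (hr x hx) hWo hxW hec hem he'c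
        he'm (hl x hx) (hrt x hx),
      fun v hv n => scale_of_not_mem hv n⟩

open Classical in
/-- **[AbsTopIII] Cor 2.9, abc-iut-L4-t4's SUCCESSOR statement of record `GlobalArchimedeanCompatibility'`
(clause (b) at print strength: a topological FIELD isomorphism `κ : ℂ ⥲ k_v` at every NF-point whose
restriction `fieldIsoScalar L x κ` to `𝒜_x` is pinned to `ι_x`), for the GENUINE datum and ANY local linear
holomorphic structure `L`** acting through its multipliers in the charts — under the chart-package
hypothesis; THE `κ` of the package at every NF-point; row b.r4 by `trans_isoUnits` (t4's
`fieldIsoScalar_compatible`). [cite: MochizukiAbsTopIII2015, Corollary 2.9 pp.64–65] -/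
theorem NFCurveData.globalArchimedeanCompatibility'_of_chartPackage_of (D : NFCurveData)
    (L : LocalLinearHolStructure D.Xtop) (isNFPoint : D.Xtop → Prop)
    (W : D.Xtop → Set D.Xtop) (e : D.Xtop → D.Xtop → ℂ) (e' : D.Xtop → ℂ → D.Xtop) (r : D.Xtop → ℝ)
    (hr : ∀ x, isNFPoint x → 0 < r x) (hW : ∀ x, isNFPoint x → IsOpen (W x) ∧ x ∈ W x)
    (he : ∀ x, isNFPoint x → ContinuousOn (e x) (W x) ∧ MapsTo (e x) (W x) (ball (e x x) (r x)))
    (he' : ∀ x, isNFPoint x →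
      ContinuousOn (e' x) (ball (e x x) (r x)) ∧ MapsTo (e' x) (ball (e x x) (r x)) (W x))
    (hl : ∀ x, isNFPoint x → ∀ v ∈ W x, e' x (e x v) = v)
    (hrt : ∀ x, isNFPoint x → ∀ w ∈ ball (e x x) (r x), e x (e' x w) = w)
    (fval : D.Fn → D.Xtop → D.kv) (vanishesAt : D.Fn → D.Xtop → Prop) (G : D.Xtop → D.Fn → ℂ → ℂ)
    (κ : ℂ ≃+* D.kv) (hκ : Continuous κ) (hκ' : Continuous κ.symm)
    (hG : ∀ x, isNFPoint x → ∀ f, vanishesAt f x → DifferentiableAt ℂ (G x f) (e x x) ∧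
      (∀ᶠ u in 𝓝 x, κ.symm (fval f u) = G x f (e x u)) ∧ fval f x = 0)
    (hvan : ∀ f x, vanishesAt f x → fval f x = 0)
    (hspan : ∀ x, isNFPoint x → ∃ f, vanishesAt f x ∧ deriv (G x f) (e x x) ≠ 0) :
    GlobalArchimedeanCompatibility' D L isNFPoint (fun _ => D.kv) (fun x f => κ (deriv (G x f) (e x x)))
      vanishesAt (fun x a b => e' x (e x a + e x b - e x x))
      (fun x n v => if v ∈ W x ∧ ‖e x v - e x x‖ < r x / 2 then e' x (e x x + (e x v - e x x) / (n : ℂ)) else x)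
      fval
      (fun x u v => e' x (e x x + ((((L.isoUnits x).symm u : ℂˣ) : ℂ) * (e x v - e x x)))) := by
  have hR := D.cor29Refined_of_chartPackage_of L isNFPoint W e e' r hr hW he he' hl hrt fval vanishesAt G κ
    hκ hκ' hG hvan hspan
  refine ⟨(D.globalArchimedeanCompatibility_of_refined _ _ _ _ _ _ _ _ _ hR).limit_depends_on_differential,
    ?_⟩
  refine ⟨fun x => {v | v ∈ W x ∧ ‖e x v - e x x‖ < r x / 2},
    fun x v => (κ (e x v - e x x)) • (LinearMap.id : D.kv →ₗ[D.kv] D.kv),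
    fun _ _ => κ, fun _ _ => hκ, fun _ _ => hκ', fun x hx => ?_, fun x₁ x₂ _ _ => ?_⟩
  · obtain ⟨hWo, hxW⟩ := hW x hx
    obtain ⟨hec, hem⟩ := he x hx
    obtain ⟨he'c, he'm⟩ := he' x hx
    refine ⟨isLocalAddDatumAt_pkg (hr x hx) hWo hxW hec he'c he'm (hl x hx) (hrt x hx),
      iotaComputesLimits_pkg κ hκ (hr x hx) hxW he'c (hl x hx) (hrt x hx) (hG x hx),
      iotaIsEmbedding_pkg κ hκ hκ' hec he'c hem (hl x hx) (fun v hv => hv.1),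
      iotaAdditive_pkg κ (hr x hx) (hrt x hx), ?_⟩
    rw [fieldIsoScalar_eq_trans]
    exact scalarFieldIso_pkg_of L κ (unitsOfFieldIso κ hκ hκ') (fun c => rfl) (hr x hx) hWo hxW hec hem he'c
      he'm (hl x hx) (hrt x hx)
  · exact fieldIsoScalar_compatible L x₁ x₂ κ hκ hκ'

open Classical in
/-- **[AbsTopIII] Cor 2.9 for the GENUINE datum with the GERM structure** `L := planeStructure.comap
(fun x ↦ e_x x)` — `𝒜_x := germAut (e_x x)`, the Prop 2.6 (a) / Cor 2.7 (e) group of germs at the chart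
image point (`= {z ↦ e_x x + c (z − e_x x)}`, `mem_germAut_iff`), transitions the translation conjugations
`germAutTrans` of Prop 2.6 (b) — refined rows under the chart-package hypothesis; `u ∈ 𝒜_x` acts near `x` AS
THE GERM through the chart, `u · v := e_x⁻¹(act_{e_x x} u (e_x v))` (`Cor29Model.act`, whose germ is `u`:
`Cor29Model.act_germ`), and the pinned scalar isomorphism is the multiplier `Cor29Model.mult (e_x x) ≫ κ^×`.
[cite: MochizukiAbsTopIII2015, Corollary 2.9 pp.64–65] -/
theorem NFCurveData.cor29Refined_of_chartPackage_germs (D : NFCurveData) (isNFPoint : D.Xtop → Prop)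
    (W : D.Xtop → Set D.Xtop) (e : D.Xtop → D.Xtop → ℂ) (e' : D.Xtop → ℂ → D.Xtop) (r : D.Xtop → ℝ)
    (hr : ∀ x, isNFPoint x → 0 < r x) (hW : ∀ x, isNFPoint x → IsOpen (W x) ∧ x ∈ W x)
    (he : ∀ x, isNFPoint x → ContinuousOn (e x) (W x) ∧ MapsTo (e x) (W x) (ball (e x x) (r x)))
    (he' : ∀ x, isNFPoint x →
      ContinuousOn (e' x) (ball (e x x) (r x)) ∧ MapsTo (e' x) (ball (e x x) (r x)) (W x))
    (hl : ∀ x, isNFPoint x → ∀ v ∈ W x, e' x (e x v) = v)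
    (hrt : ∀ x, isNFPoint x → ∀ w ∈ ball (e x x) (r x), e x (e' x w) = w)
    (fval : D.Fn → D.Xtop → D.kv) (vanishesAt : D.Fn → D.Xtop → Prop) (G : D.Xtop → D.Fn → ℂ → ℂ)
    (κ : ℂ ≃+* D.kv) (hκ : Continuous κ) (hκ' : Continuous κ.symm)
    (hG : ∀ x, isNFPoint x → ∀ f, vanishesAt f x → DifferentiableAt ℂ (G x f) (e x x) ∧
      (∀ᶠ u in 𝓝 x, κ.symm (fval f u) = G x f (e x u)) ∧ fval f x = 0)
    (hvan : ∀ f x, vanishesAt f x → fval f x = 0)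
    (hspan : ∀ x, isNFPoint x → ∃ f, vanishesAt f x ∧ deriv (G x f) (e x x) ≠ 0) :
    D.Cor29Refined (Cor29Model.planeStructure.comap (fun x : D.Xtop => e x x)) isNFPoint
      (fun _ => D.kv) (fun x f => κ (deriv (G x f) (e x x))) vanishesAt
      (fun x a b => e' x (e x a + e x b - e x x))
      (fun x n v => if v ∈ W x ∧ ‖e x v - e x x‖ < r x / 2 then e' x (e x x + (e x v - e x x) / (n : ℂ)) else x)
      fval
      (fun x u v => e' x (Cor29Model.act (e x x) u (e x v))) :=
  D.cor29Refined_of_chartPackage_of (Cor29Model.planeStructure.comap (fun x : D.Xtop => e x x)) isNFPoint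
    W e e' r hr hW he he' hl hrt fval vanishesAt G κ hκ hκ' hG hvan hspan

/-! ### At the genuine NF-point predicate and the genuine extended evaluation (p438727's terms) -/

open Classical in
/-- **[AbsTopIII] Cor 2.9, refined rows, GENUINE throughout**: the genuine datum `D`, the GENUINE NF-point
predicate (`x` is the class of a Cauchy sequence of NF-points converging to an NF-point `P`), the GENUINE
extended evaluation `fval f x := lim_j f(x_j)` and `vanishesAt f x := fval f x = 0` (p438727), and the GERM
structure `L := planeStructure.comap (fun x ↦ e_x x)` with the germ action through the charts — under the
chart-package hypothesis `hpkg`/`hG`/`hspan` at those points and `κ : ℂ ≃ k_v`.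
[cite: MochizukiAbsTopIII2015, Corollary 2.9 pp.64–65] -/
theorem NFCurveData.cor29Refined_genuine_germs (D : NFCurveData)
    (W : D.Xtop → Set D.Xtop) (e : D.Xtop → D.Xtop → ℂ) (e' : D.Xtop → ℂ → D.Xtop) (r : D.Xtop → ℝ)
    (G : D.Xtop → D.Fn → ℂ → ℂ) (κ : ℂ ≃+* D.kv) (hκ : Continuous κ) (hκ' : Continuous κ.symm)
    (hpkg : ∀ x : D.Xtop,
      (∃ (P : D.Pt) (s : {x : ℕ → D.Pt // D.IsCauchy x}), Quot.mk _ s = x ∧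
        ∀ f : D.Fn, D.eval f P ≠ none → Tendsto (fun j => D.valv f (s.1 j)) atTop (𝓝 (D.valv f P))) →
      0 < r x ∧ IsOpen (W x) ∧ x ∈ W x ∧ ContinuousOn (e x) (W x) ∧
        MapsTo (e x) (W x) (ball (e x x) (r x)) ∧ ContinuousOn (e' x) (ball (e x x) (r x)) ∧
        MapsTo (e' x) (ball (e x x) (r x)) (W x) ∧ (∀ v ∈ W x, e' x (e x v) = v) ∧
        ∀ w ∈ ball (e x x) (r x), e x (e' x w) = w)
    (hG : ∀ x : D.Xtop,
      (∃ (P : D.Pt) (s : {x : ℕ → D.Pt // D.IsCauchy x}), Quot.mk _ s = x ∧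
        ∀ f : D.Fn, D.eval f P ≠ none → Tendsto (fun j => D.valv f (s.1 j)) atTop (𝓝 (D.valv f P))) →
      ∀ f : D.Fn, limUnder atTop (fun j => D.valv f ((Quot.out x).1 j)) = 0 →
        DifferentiableAt ℂ (G x f) (e x x) ∧
          ∀ᶠ u in 𝓝 x, κ.symm (limUnder atTop (fun j => D.valv f ((Quot.out u).1 j))) = G x f (e x u))
    (hspan : ∀ x : D.Xtop,
      (∃ (P : D.Pt) (s : {x : ℕ → D.Pt // D.IsCauchy x}), Quot.mk _ s = x ∧
        ∀ f : D.Fn, D.eval f P ≠ none → Tendsto (fun j => D.valv f (s.1 j)) atTop (𝓝 (D.valv f P))) →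
      ∃ f : D.Fn, limUnder atTop (fun j => D.valv f ((Quot.out x).1 j)) = 0 ∧ deriv (G x f) (e x x) ≠ 0) :
    D.Cor29Refined (Cor29Model.planeStructure.comap (fun x : D.Xtop => e x x))
      (fun x => ∃ (P : D.Pt) (s : {x : ℕ → D.Pt // D.IsCauchy x}), Quot.mk _ s = x ∧
        ∀ f : D.Fn, D.eval f P ≠ none → Tendsto (fun j => D.valv f (s.1 j)) atTop (𝓝 (D.valv f P)))
      (fun _ => D.kv) (fun x f => κ (deriv (G x f) (e x x)))
      (fun f x => limUnder atTop (fun j => D.valv f ((Quot.out x).1 j)) = 0)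
      (fun x a b => e' x (e x a + e x b - e x x))
      (fun x n v => if v ∈ W x ∧ ‖e x v - e x x‖ < r x / 2 then e' x (e x x + (e x v - e x x) / (n : ℂ)) else x)
      (fun f x => limUnder atTop (fun j => D.valv f ((Quot.out x).1 j)))
      (fun x u v => e' x (Cor29Model.act (e x x) u (e x v))) :=
  D.cor29Refined_of_chartPackage_germs _ W e e' r (fun x hx => (hpkg x hx).1)
    (fun x hx => ⟨(hpkg x hx).2.1, (hpkg x hx).2.2.1⟩)
    (fun x hx => ⟨(hpkg x hx).2.2.2.1, (hpkg x hx).2.2.2.2.1⟩)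
    (fun x hx => ⟨(hpkg x hx).2.2.2.2.2.1, (hpkg x hx).2.2.2.2.2.2.1⟩)
    (fun x hx => (hpkg x hx).2.2.2.2.2.2.2.1) (fun x hx => (hpkg x hx).2.2.2.2.2.2.2.2)
    _ _ G κ hκ hκ' (fun x hx f hf => ⟨(hG x hx f hf).1, (hG x hx f hf).2, hf⟩) (fun _ _ h => h) hspan

open Classical in
/-- **[AbsTopIII] Cor 2.9 — abc-iut-L4-t4's SUCCESSOR statement of record `GlobalArchimedeanCompatibility'`
(clause (b) at print strength), GENUINE throughout**: genuine `D`, genuine NF-point predicate, genuine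
extended evaluation (p438727's terms), and the GERM structure `L := planeStructure.comap (fun x ↦ e_x x)` with
the germ action through the charts — under the chart-package hypothesis.  Supersedes the (L)-caveat of t4's
`globalArchimedeanCompatibility'_genuine` (p440549). [cite: MochizukiAbsTopIII2015, Corollary 2.9 pp.64–65] -/
theorem NFCurveData.globalArchimedeanCompatibility'_genuine_germs (D : NFCurveData)
    (W : D.Xtop → Set D.Xtop) (e : D.Xtop → D.Xtop → ℂ) (e' : D.Xtop → ℂ → D.Xtop) (r : D.Xtop → ℝ)
    (G : D.Xtop → D.Fn → ℂ → ℂ) (κ : ℂ ≃+* D.kv) (hκ : Continuous κ) (hκ' : Continuous κ.symm)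
    (hpkg : ∀ x : D.Xtop,
      (∃ (P : D.Pt) (s : {x : ℕ → D.Pt // D.IsCauchy x}), Quot.mk _ s = x ∧
        ∀ f : D.Fn, D.eval f P ≠ none → Tendsto (fun j => D.valv f (s.1 j)) atTop (𝓝 (D.valv f P))) →
      0 < r x ∧ IsOpen (W x) ∧ x ∈ W x ∧ ContinuousOn (e x) (W x) ∧
        MapsTo (e x) (W x) (ball (e x x) (r x)) ∧ ContinuousOn (e' x) (ball (e x x) (r x)) ∧
        MapsTo (e' x) (ball (e x x) (r x)) (W x) ∧ (∀ v ∈ W x, e' x (e x v) = v) ∧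
        ∀ w ∈ ball (e x x) (r x), e x (e' x w) = w)
    (hG : ∀ x : D.Xtop,
      (∃ (P : D.Pt) (s : {x : ℕ → D.Pt // D.IsCauchy x}), Quot.mk _ s = x ∧
        ∀ f : D.Fn, D.eval f P ≠ none → Tendsto (fun j => D.valv f (s.1 j)) atTop (𝓝 (D.valv f P))) →
      ∀ f : D.Fn, limUnder atTop (fun j => D.valv f ((Quot.out x).1 j)) = 0 →
        DifferentiableAt ℂ (G x f) (e x x) ∧
          ∀ᶠ u in 𝓝 x, κ.symm (limUnder atTop (fun j => D.valv f ((Quot.out u).1 j))) = G x f (e x u))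
    (hspan : ∀ x : D.Xtop,
      (∃ (P : D.Pt) (s : {x : ℕ → D.Pt // D.IsCauchy x}), Quot.mk _ s = x ∧
        ∀ f : D.Fn, D.eval f P ≠ none → Tendsto (fun j => D.valv f (s.1 j)) atTop (𝓝 (D.valv f P))) →
      ∃ f : D.Fn, limUnder atTop (fun j => D.valv f ((Quot.out x).1 j)) = 0 ∧ deriv (G x f) (e x x) ≠ 0) :
    GlobalArchimedeanCompatibility' D (Cor29Model.planeStructure.comap (fun x : D.Xtop => e x x))
      (fun x => ∃ (P : D.Pt) (s : {x : ℕ → D.Pt // D.IsCauchy x}), Quot.mk _ s = x ∧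
        ∀ f : D.Fn, D.eval f P ≠ none → Tendsto (fun j => D.valv f (s.1 j)) atTop (𝓝 (D.valv f P)))
      (fun _ => D.kv) (fun x f => κ (deriv (G x f) (e x x)))
      (fun f x => limUnder atTop (fun j => D.valv f ((Quot.out x).1 j)) = 0)
      (fun x a b => e' x (e x a + e x b - e x x))
      (fun x n v => if v ∈ W x ∧ ‖e x v - e x x‖ < r x / 2 then e' x (e x x + (e x v - e x x) / (n : ℂ)) else x)
      (fun f x => limUnder atTop (fun j => D.valv f ((Quot.out x).1 j)))
      (fun x u v => e' x (Cor29Model.act (e x x) u (e x v))) :=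
  D.globalArchimedeanCompatibility'_of_chartPackage_of (Cor29Model.planeStructure.comap (fun x => e x x)) _
    W e e' r (fun x hx => (hpkg x hx).1)
    (fun x hx => ⟨(hpkg x hx).2.1, (hpkg x hx).2.2.1⟩)
    (fun x hx => ⟨(hpkg x hx).2.2.2.1, (hpkg x hx).2.2.2.2.1⟩)
    (fun x hx => ⟨(hpkg x hx).2.2.2.2.2.1, (hpkg x hx).2.2.2.2.2.2.1⟩)
    (fun x hx => (hpkg x hx).2.2.2.2.2.2.2.1) (fun x hx => (hpkg x hx).2.2.2.2.2.2.2.2)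
    _ _ G κ hκ hκ' (fun x hx f hf => ⟨(hG x hx f hf).1, (hG x hx f hf).2, hf⟩) (fun _ _ h => h) hspan

/-- **The germ structure's transitions are NOT identities** (contrast with p436603's constant pull-back):
`trans x₁ x₂` is the translation conjugation `germAutTrans (e_{x₁} x₁) (e_{x₂} x₂)` of Prop 2.6 (b), and the
multiplier isomorphisms are compatible with it (row b.r4 with content: translations have derivative `1`, M9
`Cor29Model.scalarCompatibleWithTrans`). [cite: MochizukiAbsTopIII2015, Proposition 2.6 (b) p.58] -/
theorem NFCurveData.germs_trans_eq (D : NFCurveData) (e : D.Xtop → D.Xtop → ℂ) (x₁ x₂ : D.Xtop) :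
    (Cor29Model.planeStructure.comap (fun x : D.Xtop => e x x)).trans x₁ x₂ =
        germAutTrans (e x₁ x₁) (e x₂ x₂) ∧
      ScalarCompatibleWithTrans (𝕜 := ℂ) (Cor29Model.planeStructure.comap (fun x : D.Xtop => e x x)) x₁ x₂
        (Cor29Model.mult (e x₁ x₁)) (Cor29Model.mult (e x₂ x₂)) :=
  ⟨rfl, Cor29Model.scalarCompatibleWithTrans (e x₁ x₁) (e x₂ x₂)⟩

end ArchimedeanReconstruction

end Literature.AnabelianGeometry.AbsoluteAnabelian

end
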